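import Literature.Geometry.DiscreteGeometry.ShellCensusSearchCheck
import Mathlib.Data.Finset.Card
import Mathlib.Data.Fintype.Card
import Mathlib.Data.Finset.Powerset
import Mathlib.Algebra.BigOperators.Group.Finset.Basic
import Mathlib.Combinatorics.Enumerative.DoubleCounting
import Mathlib.Data.Fintype.Fin
import Mathlib.Logic.Equiv.Fin.Basic
import Mathlib.Tactic
import HarnessLib

/-!
# The census growth search: the abstract frame and the semantics of states

Topic `Literature/Geometry/DiscreteGeometry`.  DEFINITIONS (and the small counting lemmas about
them) against which the soundness of the checker `ShellCensusSearchCheck.lean` is proved in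
`ShellCensusSearchGrowth.lean`, `ShellCensusSearchLeaf.lean`, `ShellCensusSearchPhaseTwo*.lean`,
`ShellCensusSearchSound.lean`:

* codes: `TriValid`, `lset`, `tset` (image triangle under a labelling), `sortTri_spec`;
* **the abstract census frame `CF`** — a closed fan surface on the twelve labels `Fin 12` with a
  4-regular bond graph whose edges are sides and whose 3-cliques are triangles, with no dead star
  (`4T`, `3T+Q`, `3T+2H`): verbatim the hypotheses of the stub `stub_censusFinite` of the crux
  `GappedShellCensus.ShellTrichotomy` — its conclusion `CF.Concl` (bond graph = fcc / hcp /
  antiprism pattern up to a relabelling), `CF.star`, `CF.linkF`, `CF.partners`, and the counting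
  lemmas (star size = link size ≥ 4, star sizes sum to `60`, a minimum star has size `4` or `5`,
  at most two triangles on a side, closure form of the link axiom);
* the semantics of Phase-1 states (`Realizes`) and Phase-2 states (`RealizesB`), and the named
  step functions `initF`, `rowF`, `pairF` of the Phase-2 folds.
-/

namespace Literature.Geometry.DiscreteGeometry

namespace ShellCensusSearch

open Finset

/-! ### Codes -/

/-- Decoding the first vertex. [folklore] -/
theorem tv0_triCode {a b c : ℕ} (hb : b < 16) (hc : c < 16) : tv0 (triCode a b c) = a := by
  unfold tv0 triCode; omega

/-- Decoding the second vertex. [folklore] -/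
theorem tv1_triCode {a b c : ℕ} (hb : b < 16) (hc : c < 16) : tv1 (triCode a b c) = b := by
  unfold tv1 triCode; omega

/-- Decoding the third vertex. [folklore] -/
theorem tv2_triCode {a b c : ℕ} (hc : c < 16) : tv2 (triCode a b c) = c := by
  unfold tv2 triCode; omega

/-- A VALID triangle code below `n`: strictly increasing vertices `< n` and the code is their
`triCode`. [folklore] -/
def TriValid (t n : ℕ) : Prop := tv0 t < tv1 t ∧ tv1 t < tv2 t ∧ tv2 t < n ∧ t = triCode (tv0 t) (tv1 t) (tv2 t)

/-- The label set of a triangle code. [folklore] -/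
def lset (t : ℕ) : Finset ℕ := {tv0 t, tv1 t, tv2 t}

/-- The image triangle of a code under a labelling. [folklore] -/
def tset (φ : ℕ → Fin 12) (t : ℕ) : Finset (Fin 12) := (lset t).image φ

/-- `tmem` is membership in the label set. [folklore] -/
theorem tmem_iff {t v : ℕ} : tmem t v = true ↔ v ∈ lset t := by
  simp only [tmem, Bool.or_eq_true, beq_iff_eq, lset, mem_insert, mem_singleton]
  tauto

/-- `tmem` false is non-membership. [folklore] -/
theorem tmem_false_iff {t v : ℕ} : tmem t v = false ↔ v ∉ lset t := by
  rw [← tmem_iff]; simp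

/-- The label set of a valid code has three elements. [folklore] -/
theorem card_lset {t n : ℕ} (h : TriValid t n) : (lset t).card = 3 := by
  obtain ⟨h1, h2, -, -⟩ := h
  unfold lset
  rw [card_insert_of_notMem, card_insert_of_notMem, card_singleton]
  · simp only [mem_singleton]; omega
  · simp only [mem_insert, mem_singleton]; omega

/-- Labels of a valid code are `< n`. [folklore] -/
theorem lt_of_mem_lset {t n v : ℕ} (h : TriValid t n) (hv : v ∈ lset t) : v < n := by
  obtain ⟨h1, h2, h3, -⟩ := h
  simp only [lset, mem_insert, mem_singleton] at hv
  omega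

/-- Valid codes with the same label set are equal. [folklore] -/
theorem triValid_ext {t t' n : ℕ} (h : TriValid t n) (h' : TriValid t' n) (he : lset t = lset t') : t = t' := by
  obtain ⟨h1, h2, h3, h4⟩ := h
  obtain ⟨h1', h2', h3', h4'⟩ := h'
  have m0 : tv0 t ∈ lset t' := he ▸ (by simp [lset])
  have m1 : tv1 t ∈ lset t' := he ▸ (by simp [lset])
  have m2 : tv2 t ∈ lset t' := he ▸ (by simp [lset])
  have m0' : tv0 t' ∈ lset t := he.symm ▸ (by simp [lset])
  have m1' : tv1 t' ∈ lset t := he.symm ▸ (by simp [lset])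
  have m2' : tv2 t' ∈ lset t := he.symm ▸ (by simp [lset])
  simp only [lset, mem_insert, mem_singleton] at m0 m1 m2 m0' m1' m2'
  have e0 : tv0 t = tv0 t' := by omega
  have e1 : tv1 t = tv1 t' := by omega
  have e2 : tv2 t = tv2 t' := by omega
  rw [h4, h4', e0, e1, e2]

/-- Validity is monotone in the bound. [folklore] -/
theorem TriValid.mono {t n n' : ℕ} (h : TriValid t n) (hn : n ≤ n') : TriValid t n' :=
  ⟨h.1, h.2.1, lt_of_lt_of_le h.2.2.1 hn, h.2.2.2⟩

/-- **`sortTri` of three distinct labels `< n ≤ 16` is a valid code with that label set.**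
[folklore] -/
theorem sortTri_spec {a b c n : ℕ} (ha : a < n) (hb : b < n) (hc : c < n) (hn : n ≤ 16)
    (hab : a ≠ b) (hbc : b ≠ c) (hac : a ≠ c) :
    TriValid (sortTri a b c) n ∧ lset (sortTri a b c) = {a, b, c} := by
  have key : ∀ x y z : ℕ, x < y → y < z → z < n → ({x, y, z} : Finset ℕ) = {a, b, c} →
      TriValid (triCode x y z) n ∧ lset (triCode x y z) = {a, b, c} := by
    intro x y z hxy hyz hz he
    have hy : y < 16 := by omega
    have hz' : z < 16 := by omega
    refine ⟨⟨?_, ?_, ?_, ?_⟩, ?_⟩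
    · rw [tv0_triCode hy hz', tv1_triCode hy hz']; exact hxy
    · rw [tv1_triCode hy hz', tv2_triCode hz']; exact hyz
    · rw [tv2_triCode hz']; exact hz
    · rw [tv0_triCode hy hz', tv1_triCode hy hz', tv2_triCode hz']
    · rw [← he]; unfold lset; rw [tv0_triCode hy hz', tv1_triCode hy hz', tv2_triCode hz']
  unfold sortTri
  split_ifs with h1 h2 h3 h4 h5
  · exact key a b c h1 h2 hc rfl
  · exact key a c b h3 (by omega) hb (by ext x; simp only [mem_insert, mem_singleton]; omega)
  · exact key c a b (by omega) h1 hb (by ext x; simp only [mem_insert, mem_singleton]; omega)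
  · exact key b a c (by omega) h4 hc (by ext x; simp only [mem_insert, mem_singleton]; omega)
  · exact key b c a h5 (by omega) ha (by ext x; simp only [mem_insert, mem_singleton]; omega)
  · exact key c b a (by omega) (by omega) ha (by ext x; simp only [mem_insert, mem_singleton]; omega)

/-- The side index (of this checker) is symmetric in its two labels. [folklore] -/
theorem sIdx_comm (a b : ℕ) : sIdx b a = sIdx a b := by
  unfold sIdx; split_ifs <;> omega

/-- The side index (of this checker) of two labels `< 12` fits the `12 × 12` flag array.
[folklore] -/
theorem sIdx_lt {a b : ℕ} (ha : a < 12) (hb : b < 12) : sIdx a b < 12 * 12 := by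
  unfold sIdx; split_ifs <;> omega

/-- Side indices of different unordered pairs of labels `< 12` differ. [folklore] -/
theorem sIdx_ne {a b c d : ℕ} (ha : a < 12) (hb : b < 12) (hc : c < 12) (hd : d < 12)
    (h : ¬ ((a = c ∧ b = d) ∨ (a = d ∧ b = c))) : sIdx a b ≠ sIdx c d := by
  unfold sIdx; split_ifs <;> omega

/-! ### The abstract frame -/

/-- **The abstract census frame**: a closed fan surface `tri` on the twelve labels `Fin 12` (twenty
3-sets, two triangles on every side, single-cycle links in closure form) with a symmetric
irreflexive 4-regular `bond` graph whose edges are sides and whose 3-cliques are triangles, and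
NO label whose star is one of the three dead patterns `4T`, `3T+Q`, `3T+2H` (the hypotheses of the
stub `stub_censusFinite` of the crux `GappedShellCensus.ShellTrichotomy`, verbatim). [folklore] -/
structure CF where
  /-- the bond graph -/
  bond : Fin 12 → Fin 12 → Bool
  /-- the fan triangles -/
  tri : Finset (Finset (Fin 12))
  /-- symmetry -/
  bond_symm : ∀ v w, bond v w = bond w v
  /-- irreflexivity -/
  bond_irrefl : ∀ v, bond v v = false
  /-- every label has exactly four bonds -/
  bond_four : ∀ v, (Finset.univ.filter fun w => bond v w = true).card = 4
  /-- triangles are 3-sets -/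
  tri_card : ∀ S ∈ tri, S.card = 3
  /-- twenty triangles -/
  card_tri : tri.card = 20
  /-- every side lies in exactly two triangles -/
  two_per_side : ∀ S ∈ tri, ∀ s ⊆ S, s.card = 2 → (tri.filter fun S' => s ⊆ S').card = 2
  /-- bonds are sides -/
  bond_side : ∀ v w, bond v w = true → (tri.filter fun S' => ({v, w} : Finset (Fin 12)) ⊆ S').card = 2
  /-- bond 3-cliques are triangles -/
  bond_tri : ∀ a b c, a ≠ b → b ≠ c → a ≠ c → bond a b = true → bond b c = true → bond a c = true →
    ({a, b, c} : Finset (Fin 12)) ∈ tri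
  /-- links are single cycles (closure form) -/
  link : ∀ v, ∀ A ⊆ tri.filter (fun S => v ∈ S), A.Nonempty →
    (∀ S ∈ A, ∀ S' ∈ tri, v ∈ S' → (S ∩ S').card = 2 → S' ∈ A) → A = tri.filter fun S => v ∈ S
  /-- no `4T` star -/
  noFourT : ∀ v a b c d : Fin 12,
    (tri.filter fun S => v ∈ S) = {{v, a, b}, {v, b, c}, {v, c, d}, {v, d, a}} →
    bond v a = true → bond v b = true → bond v c = true → bond v d = true →
    bond a b = true → bond b c = true → bond c d = true → bond d a = true → False
  /-- no `3T+Q` star -/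
  noThreeTQ : ∀ v a b c d x : Fin 12,
    (tri.filter fun S => v ∈ S) = {{v, a, b}, {v, b, c}, {v, c, d}, {v, d, a}} →
    bond v a = true → bond v b = true → bond v c = true → bond v d = true →
    bond a b = true → bond b c = true → bond c d = true → bond d a = false → d ≠ a →
    bond d x = true → bond x a = true → bond v x = false → x ≠ v → False
  /-- no `3T+2H` star -/
  noThreeTHH : ∀ v a b c d x : Fin 12,
    (tri.filter fun S => v ∈ S) = {{v, a, b}, {v, b, c}, {v, c, d}, {v, d, x}, {v, a, x}} →
    bond v a = true → bond v b = true → bond v c = true → bond v d = true →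
    bond a b = true → bond b c = true → bond c d = true → bond d x = true → bond a x = true →
    bond v x = false → v ≠ x → False

/-- The edge list of the labelled hexagonal antiprism, as in the crux. [folklore] -/
def apPairs : List (ℕ × ℕ) :=
  [(0, 1), (1, 2), (2, 3), (3, 4), (4, 5), (0, 5), (6, 7), (7, 8), (8, 9), (9, 10), (10, 11), (6, 11), (0, 6), (1, 7),
   (2, 8), (3, 9), (4, 10), (5, 11), (1, 6), (2, 7), (3, 8), (4, 9), (5, 10), (0, 11)]

/-- **The conclusion**: up to a relabelling, the bond graph is the cuboctahedral (`patAdj 0`), the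
anticuboctahedral (`patAdj 1`) or the antiprism (`patAdj 2`) graph. [folklore] -/
def CF.Concl (M : CF) : Prop :=
  ∃ σ : Equiv.Perm (Fin 12), ∃ i, i < 3 ∧ ∀ v w : Fin 12, v ≠ w → (M.bond (σ v) (σ w) = true ↔ patAdj i v w = true)

namespace CF

variable (M : CF)

/-- The star of a label: the triangles containing it. [folklore] -/
def star (u : Fin 12) : Finset (Finset (Fin 12)) := M.tri.filter fun S => u ∈ S

/-- The link of a label: the other labels of its triangles. [folklore] -/
def linkF (u : Fin 12) : Finset (Fin 12) := Finset.univ.filter fun w => w ≠ u ∧ ∃ S ∈ M.star u, w ∈ S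

/-- The bond partners of a label. [folklore] -/
def partners (x : Fin 12) : Finset (Fin 12) := Finset.univ.filter fun y => M.bond x y = true

variable {M}

/-- Membership in the star. [folklore] -/
theorem mem_star {u : Fin 12} {S : Finset (Fin 12)} : S ∈ M.star u ↔ S ∈ M.tri ∧ u ∈ S := Finset.mem_filter

/-- **At most two triangles on a side.** [folklore] -/
theorem at_most_two {a b : Fin 12} (hab : a ≠ b) {S₁ S₂ S₃ : Finset (Fin 12)} (h₁ : S₁ ∈ M.tri) (h₂ : S₂ ∈ M.tri)
    (h₃ : S₃ ∈ M.tri) (ha₁ : a ∈ S₁) (hb₁ : b ∈ S₁) (ha₂ : a ∈ S₂) (hb₂ : b ∈ S₂) (ha₃ : a ∈ S₃) (hb₃ : b ∈ S₃) :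
    S₁ = S₂ ∨ S₁ = S₃ ∨ S₂ = S₃ := by
  by_contra hne
  push Not at hne
  have hsub : ({a, b} : Finset (Fin 12)) ⊆ S₁ := by
    intro x hx; simp only [mem_insert, mem_singleton] at hx; rcases hx with rfl | rfl <;> assumption
  have h2 := M.two_per_side S₁ h₁ {a, b} hsub (card_pair hab)
  have hsub3 : ({S₁, S₂, S₃} : Finset (Finset (Fin 12))) ⊆ M.tri.filter fun S' => ({a, b} : Finset (Fin 12)) ⊆ S' := by
    intro S hS
    simp only [mem_insert, mem_singleton] at hS
    rw [mem_filter]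
    rcases hS with rfl | rfl | rfl
    · exact ⟨h₁, hsub⟩
    · refine ⟨h₂, ?_⟩; intro x hx; simp only [mem_insert, mem_singleton] at hx; rcases hx with rfl | rfl <;> assumption
    · refine ⟨h₃, ?_⟩; intro x hx; simp only [mem_insert, mem_singleton] at hx; rcases hx with rfl | rfl <;> assumption
  have hc := card_le_card hsub3
  rw [h2, card_insert_of_notMem, card_insert_of_notMem, card_singleton] at hc
  · omega
  · simpa using hne.2.2
  · simp only [mem_insert, mem_singleton, not_or]; exact ⟨hne.1, hne.2.1⟩

/-- **A second triangle on every side.** [folklore] -/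
theorem exists_second {a b : Fin 12} (hab : a ≠ b) {S : Finset (Fin 12)} (hS : S ∈ M.tri) (ha : a ∈ S) (hb : b ∈ S) :
    ∃ S' ∈ M.tri, S' ≠ S ∧ a ∈ S' ∧ b ∈ S' := by
  have hsub : ({a, b} : Finset (Fin 12)) ⊆ S := by
    intro x hx; simp only [mem_insert, mem_singleton] at hx; rcases hx with rfl | rfl <;> assumption
  have h2 := M.two_per_side S hS {a, b} hsub (card_pair hab)
  obtain ⟨X, Y, hXY, hXYeq⟩ := card_eq_two.1 h2
  have hX : X ∈ M.tri.filter fun S' => ({a, b} : Finset (Fin 12)) ⊆ S' := hXYeq ▸ (by simp)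
  have hY : Y ∈ M.tri.filter fun S' => ({a, b} : Finset (Fin 12)) ⊆ S' := hXYeq ▸ (by simp)
  rw [mem_filter] at hX hY
  by_cases hSX : S = X
  · exact ⟨Y, hY.1, fun h => hXY (h.trans hSX).symm, hY.2 (by simp), hY.2 (by simp)⟩
  · exact ⟨X, hX.1, fun h => hSX h.symm, hX.2 (by simp), hX.2 (by simp)⟩

/-- A 3-set containing `u` and meeting another set containing `u` in two elements shares with it
some `w ≠ u`. [folklore] -/
theorem exists_shared {u : Fin 12} {S S' : Finset (Fin 12)} (hu : u ∈ S) (hu' : u ∈ S') (h2 : (S ∩ S').card = 2) :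
    ∃ w, w ≠ u ∧ w ∈ S ∧ w ∈ S' := by
  obtain ⟨x, y, hxy, he⟩ := card_eq_two.1 h2
  have hux : u ∈ S ∩ S' := mem_inter.2 ⟨hu, hu'⟩
  rw [he] at hux
  simp only [mem_insert, mem_singleton] at hux
  have hx : x ∈ S ∩ S' := he ▸ (by simp)
  have hy : y ∈ S ∩ S' := he ▸ (by simp)
  rw [mem_inter] at hx hy
  rcases hux with rfl | rfl
  · exact ⟨y, hxy.symm, hy.1, hy.2⟩
  · exact ⟨x, hxy, hx.1, hx.2⟩

/-- **Closure form of the link axiom, side version**: a nonempty family of triangles at `u`,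
closed under passing to any triangle at `u` through another common vertex, is the whole star.
[folklore] -/
theorem star_eq_of_closed {u : Fin 12} {A : Finset (Finset (Fin 12))} (hA : A ⊆ M.star u) (hne : A.Nonempty)
    (hcl : ∀ S ∈ A, ∀ w ∈ S, w ≠ u → ∀ S' ∈ M.tri, u ∈ S' → w ∈ S' → S' ∈ A) : A = M.star u := by
  refine M.link u A hA hne ?_
  intro S hS S' hS' huS' h2
  have huS : u ∈ S := (mem_star.1 (hA hS)).2
  obtain ⟨w, hwu, hwS, hwS'⟩ := exists_shared huS huS' h2
  exact hcl S hS w hwS hwu S' hS' huS' hwS'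

/-- Stars consist of 3-sets. [folklore] -/
theorem card_of_mem_star {u : Fin 12} {S : Finset (Fin 12)} (h : S ∈ M.star u) : S.card = 3 :=
  M.tri_card S (mem_star.1 h).1

/-- **The star has as many triangles as the link has labels** (double counting the incidences:
every triangle at `u` has two other vertices, every link label lies in exactly two triangles at
`u`). [folklore] -/
theorem card_star_eq_card_linkF (u : Fin 12) : (M.star u).card = (M.linkF u).card := by
  classical
  -- Σ_{S ∈ star} |{w ∈ link : w ∈ S}| = Σ_{w ∈ link} |{S ∈ star : w ∈ S}|
  have hdc := Finset.sum_card_bipartiteAbove_eq_sum_card_bipartiteBelow (s := M.star u) (t := M.linkF u)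
    (r := fun S w => w ∈ S)
  -- left: each term is 2
  have hl : ∀ S ∈ M.star u, (Finset.bipartiteAbove (fun S w => w ∈ S) (M.linkF u) S).card = 2 := by
    intro S hS
    have hS3 := card_of_mem_star hS
    have huS := (mem_star.1 hS).2
    have : Finset.bipartiteAbove (fun S w => w ∈ S) (M.linkF u) S = S.erase u := by
      ext w
      simp only [Finset.bipartiteAbove, mem_filter, linkF, mem_univ, true_and, mem_erase]
      constructor
      · rintro ⟨⟨hwu, -⟩, hwS⟩; exact ⟨hwu, hwS⟩
      · rintro ⟨hwu, hwS⟩; exact ⟨⟨hwu, S, hS, hwS⟩, hwS⟩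
    rw [this, card_erase_of_mem huS, hS3]
  -- right: each term is 2
  have hr : ∀ w ∈ M.linkF u, (Finset.bipartiteBelow (fun S w => w ∈ S) (M.star u) w).card = 2 := by
    intro w hw
    simp only [linkF, mem_filter, mem_univ, true_and] at hw
    obtain ⟨hwu, S, hS, hwS⟩ := hw
    have hSt := (mem_star.1 hS).1
    have huS := (mem_star.1 hS).2
    have hsub : ({u, w} : Finset (Fin 12)) ⊆ S := by
      intro x hx; simp only [mem_insert, mem_singleton] at hx; rcases hx with rfl | rfl <;> assumption
    have h2 := M.two_per_side S hSt {u, w} hsub (card_pair hwu.symm)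
    have : Finset.bipartiteBelow (fun S w => w ∈ S) (M.star u) w = M.tri.filter fun S' => ({u, w} : Finset (Fin 12)) ⊆ S' := by
      ext S'
      simp only [Finset.bipartiteBelow, mem_filter, mem_star]
      constructor
      · rintro ⟨⟨hS', huS'⟩, hwS'⟩
        refine ⟨hS', ?_⟩
        intro x hx; simp only [mem_insert, mem_singleton] at hx; rcases hx with rfl | rfl <;> assumption
      · rintro ⟨hS', hsub'⟩
        exact ⟨⟨hS', hsub' (by simp)⟩, hsub' (by simp)⟩
    rw [this, h2]
  rw [sum_congr rfl hl, sum_congr rfl hr] at hdc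
  simp only [sum_const, smul_eq_mul] at hdc
  omega

/-- Bond partners lie in the link. [folklore] -/
theorem mem_linkF_of_bond {u w : Fin 12} (h : M.bond u w = true) : w ∈ M.linkF u := by
  have hwu : w ≠ u := by
    rintro rfl; rw [M.bond_irrefl] at h; exact Bool.false_ne_true h
  have h2 := M.bond_side u w h
  have hpos : 0 < (M.tri.filter fun S' => ({u, w} : Finset (Fin 12)) ⊆ S').card := by rw [h2]; norm_num
  obtain ⟨S, hS⟩ := card_pos.1 hpos
  rw [mem_filter] at hS
  simp only [linkF, mem_filter, mem_univ, true_and]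
  exact ⟨hwu, S, mem_star.2 ⟨hS.1, hS.2 (by simp)⟩, hS.2 (by simp)⟩

/-- **Every star has at least four triangles.** [folklore] -/
theorem four_le_card_star (u : Fin 12) : 4 ≤ (M.star u).card := by
  rw [card_star_eq_card_linkF, ← M.bond_four u]
  apply card_le_card
  intro w hw
  rw [mem_filter] at hw
  exact mem_linkF_of_bond hw.2

/-- **The star sizes sum to `60`.** [folklore] -/
theorem sum_card_star : ∑ u, (M.star u).card = 60 := by
  classical
  have hdc := Finset.sum_card_bipartiteAbove_eq_sum_card_bipartiteBelow (s := (Finset.univ : Finset (Fin 12)))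
    (t := M.tri) (r := fun u S => u ∈ S)
  have hl : ∀ u ∈ (Finset.univ : Finset (Fin 12)), (Finset.bipartiteAbove (fun u S => u ∈ S) M.tri u).card = (M.star u).card := by
    intro u _; rfl
  have hr : ∀ S ∈ M.tri, (Finset.bipartiteBelow (fun u S => u ∈ S) Finset.univ S).card = 3 := by
    intro S hS
    have : Finset.bipartiteBelow (fun u S => u ∈ S) Finset.univ S = S := by
      ext u; simp [Finset.bipartiteBelow]
    rw [this, M.tri_card S hS]
  rw [sum_congr rfl hl, sum_congr rfl hr] at hdc
  simp only [sum_const, smul_eq_mul, M.card_tri] at hdc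
  omega

/-- **A label of minimum star size exists, and its star size is `4` or `5`.** [folklore] -/
theorem exists_min_star : ∃ v₀ : Fin 12, (∀ u, (M.star v₀).card ≤ (M.star u).card) ∧
    (4 ≤ (M.star v₀).card ∧ (M.star v₀).card ≤ 5) := by
  obtain ⟨v₀, -, hmin⟩ := Finset.exists_min_image Finset.univ (fun u => (M.star u).card) ⟨0, mem_univ _⟩
  refine ⟨v₀, fun u => hmin u (mem_univ u), four_le_card_star v₀, ?_⟩
  by_contra h
  have h6 : ∀ u, 6 ≤ (M.star u).card := fun u => le_trans (by omega) (hmin u (mem_univ u))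
  have hs := sum_card_star (M := M)
  have : 72 ≤ ∑ u, (M.star u).card := le_trans (by simp) (Finset.sum_le_sum fun u _ => h6 u)
  omega

/-- A bond has two distinct ends. [folklore] -/
theorem ne_of_bond {u w : Fin 12} (h : M.bond u w = true) : u ≠ w := by
  rintro rfl; rw [M.bond_irrefl] at h; exact Bool.false_ne_true h

end CF

/-! ### Semantics of states -/

/-- **A Phase-1 state realized by a frame under a labelling.** [folklore] -/
structure Realizes (M : CF) (φ : ℕ → Fin 12) (s : St) : Prop where
  /-- at most twelve labels -/
  n_le : s.n ≤ 12
  /-- the root labels are used -/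
  three_le : 3 ≤ s.n
  /-- the root has star size `m0` -/
  m0_eq : (M.star (φ 0)).card = s.m0
  /-- which is minimal -/
  m0_min : ∀ u, s.m0 ≤ (M.star u).card
  /-- the root bond -/
  bond01 : M.bond (φ 0) (φ 1) = true
  /-- the labelling is injective on the used labels -/
  inj : ∀ p q, p < s.n → q < s.n → φ p = φ q → p = q
  /-- placed codes are valid -/
  valid : ∀ t ∈ s.tris.toList, TriValid t s.n
  /-- placed triangles are triangles of `M` -/
  mem : ∀ t ∈ s.tris.toList, tset φ t ∈ M.tri
  /-- no repetition -/
  nodup : s.tris.toList.Nodup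
  /-- every used label lies on a placed triangle -/
  used : ∀ v, v < s.n → ∃ t ∈ s.tris.toList, tmem t v = true
  /-- the flags are the root flags: only the bond `0–1` is recorded -/
  gb_sem0 : ∀ a b, s.ggb a b = if sIdx a b = sIdx 0 1 then 2 else 0
  /-- `144` flags -/
  gb_size : s.gb.size = 144
  /-- twelve closedness flags -/
  cl_size : s.cl.size = 12
  /-- closed labels are used … -/
  cl_lt : ∀ v, s.isCl v = true → v < s.n
  /-- … and have their whole star placed -/
  cl_sem : ∀ v, s.isCl v = true → ∀ T ∈ M.tri, φ v ∈ T → ∃ t ∈ s.tris.toList, tset φ t = T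

/-- **A Phase-2 state realized by a frame under a (bijective) labelling**: all twelve labels, the
placed triangles are exactly the triangles of `M`, every label closed, and the recorded flags are
correct (`2` = bond, `1` = no bond; never more than `2`). [folklore] -/
structure RealizesB (M : CF) (φ : ℕ → Fin 12) (s : St) : Prop where
  /-- twelve labels -/
  n_eq : s.n = 12
  /-- injective labelling -/
  inj : ∀ p q, p < 12 → q < 12 → φ p = φ q → p = q
  /-- placed codes are valid -/
  valid : ∀ t ∈ s.tris.toList, TriValid t 12
  /-- placed triangles are triangles of `M` -/
  mem : ∀ t ∈ s.tris.toList, tset φ t ∈ M.tri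
  /-- no repetition -/
  nodup : s.tris.toList.Nodup
  /-- every triangle of `M` is placed -/
  complete : ∀ T ∈ M.tri, ∃ t ∈ s.tris.toList, tset φ t = T
  /-- every label is closed -/
  cl_all : ∀ v, v < 12 → s.isCl v = true
  /-- `144` flags -/
  gb_size : s.gb.size = 144
  /-- flag `2` is a bond -/
  flag2 : ∀ a b, a < 12 → b < 12 → a ≠ b → s.ggb a b = 2 → M.bond (φ a) (φ b) = true
  /-- flag `1` is a non-bond -/
  flag1 : ∀ a b, a < 12 → b < 12 → a ≠ b → s.ggb a b = 1 → M.bond (φ a) (φ b) = false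
  /-- flags are at most `2` -/
  flag_le : ∀ a b, s.ggb a b ≤ 2

/-- The Phase-2 flag initialiser as a fold. [folklore] -/
def initF (s : St) : Array ℕ → ℕ → Array ℕ := fun g i =>
  let a := i / 12
  let b := i % 12
  if a < b ∧ s.gsc a b = 0 then g.setIfInBounds (sIdx a b) 1 else g

/-- The row step of `assignWith`. [folklore] -/
def rowF (v : ℕ) (B : List ℕ) : St → ℕ → St := fun s' u =>
  if u = v then s' else if B.contains u then s'.sgb v u 2 else s'.sgb v u 1

/-- The pair step of `assignWith`. [folklore] -/
def pairF (v w1 : ℕ) : Option St → ℕ → Option St := fun os' w2 =>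
  match os' with
  | none => none
  | some s' =>
    if w1 < w2 ∧ !(s'.placed v w1 w2) then
      if s'.ggb w1 w2 = 2 then none else some (s'.sgb w1 w2 1)
    else some s'

end ShellCensusSearch

end Literature.Geometry.DiscreteGeometry
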